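import Literature.AlgebraicGeometry.Frobenioids.PadicKummerThm24iCupProduct
import Literature.AlgebraicGeometry.Frobenioids.PadicKummerDualityIso
import Literature.AlgebraicGeometry.Frobenioids.KummerLocalDualityBinding
import Literature.AlgebraicGeometry.Frobenioids.PadicKummerSettingGaloisProofs
import Literature.AnabelianGeometry.AbsoluteAnabelian.MLFGaloisGroupsHolds
import Literature.NumberTheory.GaloisRepresentations.LocalFieldFiniteExtension
import Literature.NumberTheory.GaloisRepresentations.LocalFieldPadicProofs
import HarnessLib

/-!
# Frobenioids II, Theorem 2.4 (i) AT THE ARITHMETIC BINDING: no cohomological hypothesis left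

Mochizuki, *The geometry of Frobenioids II*, Kyushu J. Math. **62** (2008) 401–460, §2, Theorem 2.4
(i) pp. 19–20 [cite: MochizukiFrdII2008, Thm 2.4 (i) p.19]: "`Φ₁` is fieldwise saturated if and only
if `Φ₂` is. Moreover, `p₁ = p₂`; `Ψ` maps `(N, H₁)`-saturated objects to `(N, H₂)`-saturated objects
and induces isomorphisms … which are compatible with the respective Kummer and reciprocity maps";
Definition 2.2 (ii) p. 18: `F_N(A) ≅ H²(H, μ_N(A)) ≅ ℤ/Nℤ` and the duality isomorphism
`H¹(H, μ_N(A)) ⥲ H^{ab} ⊗ F_N(A)` "by the well-known duality theory of nonarchimedean local fields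
[NSW 7.2.6]".

PROOF-ONLY final glue (seat abc-iut-L1-t7, gen 4; cell row W12 / SUBDAG-FrdII-Thm24 row L12) of the
pieces now ALL in the tree, at abc-iut-L1-t7's Galois binding `Def22Context.ofGalois` (`G := G_K`
for `K` a finite extension of `ℚ_p`, `H ⊆ G_K` open normal, `Aut_E(A_E) = Gal(L/K)`) and at the
zero-parameter arithmetic context `Def22Context.ofLocalField` (`O^□(A) = O^□_L`):
* the input `p₁ = p₂` is [AbsAnab] Prop. 1.2.1 (i), PROVED in the tree
  (`galoisMLF_iso_residueChar_eq_holds`, abc-iut-L4; applied through abc-iut-L1-d4's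
  `residueChar_eq_of_iso_ofGalois`);
* the local Tate duality input `hH` of the cup-product duality isomorphism is abc-iut-w5-d207's
  `cupDualH_bijective_ofGalois` (`KummerLocalDualityBinding.lean`), here re-exported in the
  "finite extension of `ℚ_p`" binder form of [AbsAnab] (`cupDualH_bijective_ofGalois_mlf`: the
  local-field structure of `K ⊇ ℚ_p` is the tree's `FiniteExtension.isNonarchimedeanLocalField` over
  `Padic.isNonarchimedeanLocalField_holds`; the absolute Galois group does not depend on it);
* the duality isomorphisms are abc-iut-L2-t12's CONSTRUCTED `dualityIsoOfLocalDuality`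
  (`PadicKummerDualityIso.lean`) and the assembly is abc-iut-L1-t7's `thm24i_of_cupProduct`.

Results: `thm24i_ofGalois` — **Theorem 2.4 (i) for an isomorphism of two Galois contexts over
finite extensions `Kᵢ ⊇ ℚ_{pᵢ}`, conditional on EXACTLY `hfs : fs₁ ↔ fs₂`** ("`Φ₁` fieldwise
saturated iff `Φ₂`", [FrdI] Cor. 4.10/4.11 — the Frobenioid-side row L03, a statement about the
divisor monoids, invisible at the Galois level) — given the setting data: `G_{Kᵢ}`-equivariant
identifications `μ_N(Aᵢ) ≅ μ_N(K̄ᵢ)` (`MuModel`), one isomorphism `F_N(A₁) ≅ ℤ/Nℤ` fixing the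
normalisation of `θ` (any; it exists by `nonempty_fn_equiv_zmod_ofGalois_mlf`), and the
`(N, H₁)`-saturation of `A₁` (Theorem 2.4 concerns saturated objects; they exist cofinally,
`PadicKummerSaturatedPullback.lean`); `thm24i_ofLocalField` — the same at `ofLocalField`
(`μ_N(K̄) ⊆ L`, `O^□_L ∋` the `N`-th roots of unity of `L`). The local compactness of `H` is an
instance hypothesis discharged by `locallyCompactSpace_H_ofGalois_mlf` (no local instances in this
file). Nothing here concerns [IUTchIII]; classical Galois cohomology; universe `0`.
-/

noncomputable section

namespace Literature.AlgebraicGeometry.Frobenioids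

namespace PadicKummer

namespace Def22Context

open Field IntermediateField Kummer
open Literature.NumberTheory.GaloisRepresentations
open Literature.AnabelianGeometry.AbsoluteAnabelian

/-! ### The Galois binding over a finite extension of `ℚ_p` ([AbsAnab] binder form) -/

section MLF

variable (p : ℕ) [Fact p.Prime] {K : Type} [Field K] [Algebra ℚ_[p] K] [FiniteDimensional ℚ_[p] K]
  (L : IntermediateField K (AlgebraicClosure K)) [Normal K L] [FiniteDimensional K L]
  (H : Subgroup (absoluteGaloisGroup K)) [H.Normal] (hH : IsOpen (H : Set (absoluteGaloisGroup K)))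
  {AutC O : Type} [Group AutC] [CommMonoid O] [IsCancelMul O] [MulDistribMulAction AutC O]
  [MulDistribMulAction (L ≃ₐ[K] L) O] (res : AutC →* (L ≃ₐ[K] L))
  (res_smul : ∀ (α : AutC) (x : O), res α • x = α • x) {N : ℕ} (m : MuModel L O N)

omit [FiniteDimensional ℚ_[p] K] in
include p in
/-- `H` is locally compact at the Galois binding over a finite extension `K` of `ℚ_p` (`H` is open,
hence closed, in the profinite `G_K`; FrdII p. 17 "`H ⊆ G` a normal open subgroup"; `K ⊇ ℚ_p` has
characteristic `0`). [cite: MochizukiFrdII2008, Def 2.2 (i) p.17] -/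
theorem locallyCompactSpace_H_ofGalois_mlf : LocallyCompactSpace (ofGalois L H hH res res_smul).H :=
  haveI : CharZero K := charZero_of_injective_algebraMap (algebraMap ℚ_[p] K).injective
  locallyCompactSpace_H_ofGalois L O H hH res res_smul

include p m in
/-- **Local Tate duality for the open `H ≤ G_K` at the Galois binding, `K` a finite extension of
`ℚ_p`** (FrdII Def. 2.2 (ii) p. 18 "by the well-known duality theory of nonarchimedean local fields
[NSW 7.2.6], the cup product … determines an isomorphism"): abc-iut-w5-d207's
`cupDualH_bijective_ofGalois`, with the non-archimedean local field structure of `K ⊇ ℚ_p` supplied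
by `FiniteExtension.isNonarchimedeanLocalField` / `Padic.isNonarchimedeanLocalField_holds` (the
conclusion only involves `G_K` with its Krull topology). [cite: MochizukiFrdII2008, Def 2.2 (ii) p.18] -/
theorem cupDualH_bijective_ofGalois_mlf [NeZero N] [LocallyCompactSpace (ofGalois L H hH res res_smul).H] :
    Function.Bijective (cupDualHOf (ofGalois L H hH res res_smul) N) := by
  haveI : IsNonarchimedeanLocalField ℚ_[p] := Padic.isNonarchimedeanLocalField_holds p
  letI := FiniteExtension.valuativeRel ℚ_[p] K
  letI := FiniteExtension.topologicalSpace ℚ_[p] K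
  haveI : IsNonarchimedeanLocalField K := FiniteExtension.isNonarchimedeanLocalField ℚ_[p] K
  haveI : CharZero K := charZero_of_injective_algebraMap (algebraMap ℚ_[p] K).injective
  exact cupDualH_bijective_ofGalois L O H hH res res_smul m

include p m in
/-- **"`F_N(A) ≅ ℤ/Nℤ`" at the Galois binding, `K` a finite extension of `ℚ_p`** (FrdII Def. 2.2
(ii) p. 18 "so `F_N(A) ≅ H²(H, μ_N(A)) ≅ ℤ/Nℤ` [NSW 7.2.6]"), for an `(N, H)`-saturated `A`:
abc-iut-L1-d4's `nonempty_fn_equiv_zmod_ofGalois` in the [AbsAnab] binder form.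
[cite: MochizukiFrdII2008, Def 2.2 (ii) p.18] -/
theorem nonempty_fn_equiv_zmod_ofGalois_mlf [NeZero N]
    (h : IsNHSaturated (ofGalois L H hH res res_smul) N) :
    Nonempty (FN (ofGalois L H hH res res_smul) N ≃+ ZMod N) := by
  haveI : IsNonarchimedeanLocalField ℚ_[p] := Padic.isNonarchimedeanLocalField_holds p
  letI := FiniteExtension.valuativeRel ℚ_[p] K
  letI := FiniteExtension.topologicalSpace ℚ_[p] K
  haveI : IsNonarchimedeanLocalField K := FiniteExtension.isNonarchimedeanLocalField ℚ_[p] K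
  haveI : CharZero K := charZero_of_injective_algebraMap (algebraMap ℚ_[p] K).injective
  exact nonempty_fn_equiv_zmod_ofGalois L O H hH res res_smul m h

end MLF

/-! ### Theorem 2.4 (i) at the Galois binding -/

section Thm24iGalois

variable {p₁ p₂ : ℕ} [Fact p₁.Prime] [Fact p₂.Prime]
  {K₁ : Type} [Field K₁] [Algebra ℚ_[p₁] K₁] [FiniteDimensional ℚ_[p₁] K₁]
  {K₂ : Type} [Field K₂] [Algebra ℚ_[p₂] K₂] [FiniteDimensional ℚ_[p₂] K₂]
  {L₁ : IntermediateField K₁ (AlgebraicClosure K₁)} [Normal K₁ L₁] [FiniteDimensional K₁ L₁]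
  {H₁ : Subgroup (absoluteGaloisGroup K₁)} [H₁.Normal]
  {hH₁ : IsOpen (H₁ : Set (absoluteGaloisGroup K₁))}
  {AutC₁ O₁ : Type} [Group AutC₁] [CommMonoid O₁] [IsCancelMul O₁] [MulDistribMulAction AutC₁ O₁]
  [MulDistribMulAction (L₁ ≃ₐ[K₁] L₁) O₁] {res₁ : AutC₁ →* (L₁ ≃ₐ[K₁] L₁)}
  {res_smul₁ : ∀ (α : AutC₁) (x : O₁), res₁ α • x = α • x}
  {L₂ : IntermediateField K₂ (AlgebraicClosure K₂)} [Normal K₂ L₂] [FiniteDimensional K₂ L₂]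
  {H₂ : Subgroup (absoluteGaloisGroup K₂)} [H₂.Normal]
  {hH₂ : IsOpen (H₂ : Set (absoluteGaloisGroup K₂))}
  {AutC₂ O₂ : Type} [Group AutC₂] [CommMonoid O₂] [IsCancelMul O₂] [MulDistribMulAction AutC₂ O₂]
  [MulDistribMulAction (L₂ ≃ₐ[K₂] L₂) O₂] {res₂ : AutC₂ →* (L₂ ≃ₐ[K₂] L₂)}
  {res_smul₂ : ∀ (α : AutC₂) (x : O₂), res₂ α • x = α • x}
  (e : Iso (ofGalois L₁ H₁ hH₁ res₁ res_smul₁) (ofGalois L₂ H₂ hH₂ res₂ res_smul₂))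
  (N : ℕ) [NeZero N] (m₁ : MuModel L₁ O₁ N) (m₂ : MuModel L₂ O₂ N)
  [LocallyCompactSpace (ofGalois L₁ H₁ hH₁ res₁ res_smul₁).H]
  [LocallyCompactSpace (ofGalois L₂ H₂ hH₂ res₂ res_smul₂).H]

/-- **Theorem 2.4 (i) at the Galois binding** (FrdII pp. 19–20). Let `Kᵢ ⊇ ℚ_{pᵢ}` be finite
extensions ("the finite extension of `ℚ_{pᵢ}` determined by `Gᵢ`"), `Xᵢ = ofGalois Lᵢ Hᵢ …` the
Definition 2.2 contexts of objects `Aᵢ` with `A_{i,E} = Spec Lᵢ`, `Hᵢ ⊆ G_{Kᵢ}` open normal,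
`μ_N(Aᵢ) ≅ μ_N(K̄ᵢ)` equivariantly (`mᵢ`), and `e : X₁ ≅ X₂` the context isomorphism "induced by
`Ψ`". Then for `A₁` `(N, H₁)`-saturated and any normalisation `eFN₁ : F_N(A₁) ≅ ℤ/Nℤ`, the typed
`Thm24i` holds for `p₁`, `p₂`, the comparison data `e.thm24Data N` and THE cup-product duality
isomorphisms `ιᵢ = Xᵢ.dualityIsoOfLocalDuality …` (Def. 2.2 (ii) p. 18; their local-duality inputs
are `cupDualH_bijective_ofGalois_mlf`, the side-`2` data are transported along `e`): "`Φ₁`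
fieldwise saturated iff `Φ₂`" (= the hypothesis `hfs`, [FrdI] Cor. 4.10/4.11, Frobenioid side),
"`p₁ = p₂`" (PROVED: [AbsAnab] Prop. 1.2.1 (i), `galoisMLF_iso_residueChar_eq_holds`), the
saturation transfer, and the Kummer and reciprocity compatibilities (PROVED). Conditional on
exactly `hfs`. [cite: MochizukiFrdII2008, Thm 2.4 (i) p.19] -/
theorem thm24i_ofGalois (fs₁ fs₂ : Prop) (hfs : fs₁ ↔ fs₂)
    (eFN₁ : FN (ofGalois L₁ H₁ hH₁ res₁ res_smul₁) N ≃+ ZMod N)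
    (hc₁ : IsNHSaturated (ofGalois L₁ H₁ hH₁ res₁ res_smul₁) N) :
    Thm24i (ofGalois L₁ H₁ hH₁ res₁ res_smul₁) (ofGalois L₂ H₂ hH₂ res₂ res_smul₂) N p₁ p₂ fs₁ fs₂
      (e.thm24Data N)
      ((ofGalois L₁ H₁ hH₁ res₁ res_smul₁).dualityIsoOfLocalDuality N eFN₁ hc₁
        (cupDualH_bijective_ofGalois_mlf p₁ L₁ H₁ hH₁ res₁ res_smul₁ m₁))
      ((ofGalois L₂ H₂ hH₂ res₂ res_smul₂).dualityIsoOfLocalDuality N ((e.isoFN N).symm.trans eFN₁)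
        ((e.isNHSaturated_iff N).mp hc₁)
        (cupDualH_bijective_ofGalois_mlf p₂ L₂ H₂ hH₂ res₂ res_smul₂ m₂)) :=
  e.thm24i_of_cupProduct N p₁ p₂ fs₁ fs₂
    (residueChar_eq_of_iso_ofGalois e galoisMLF_iso_residueChar_eq_holds) hfs eFN₁ hc₁
    (cupDualH_bijective_ofGalois_mlf p₁ L₁ H₁ hH₁ res₁ res_smul₁ m₁)
    (cupDualH_bijective_ofGalois_mlf p₂ L₂ H₂ hH₂ res₂ res_smul₂ m₂)

/-- **Theorem 2.4 (i) at the Galois binding, both normalisations given** (FrdII pp. 19–20): as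
`thm24i_ofGalois`, with `F_N(A₂) ≅ ℤ/Nℤ` and the `(N, H₂)`-saturation of `A₂` given rather than
transported (the duality isomorphisms do not depend on these choices: `θ` and the cup product are
canonical, only their bijectivity is witnessed). Conditional on exactly `hfs`.
[cite: MochizukiFrdII2008, Thm 2.4 (i) p.19] -/
theorem thm24i_ofGalois₂ (fs₁ fs₂ : Prop) (hfs : fs₁ ↔ fs₂)
    (eFN₁ : FN (ofGalois L₁ H₁ hH₁ res₁ res_smul₁) N ≃+ ZMod N)
    (eFN₂ : FN (ofGalois L₂ H₂ hH₂ res₂ res_smul₂) N ≃+ ZMod N)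
    (hc₁ : IsNHSaturated (ofGalois L₁ H₁ hH₁ res₁ res_smul₁) N)
    (hc₂ : IsNHSaturated (ofGalois L₂ H₂ hH₂ res₂ res_smul₂) N) :
    Thm24i (ofGalois L₁ H₁ hH₁ res₁ res_smul₁) (ofGalois L₂ H₂ hH₂ res₂ res_smul₂) N p₁ p₂ fs₁ fs₂
      (e.thm24Data N)
      ((ofGalois L₁ H₁ hH₁ res₁ res_smul₁).dualityIsoOfLocalDuality N eFN₁ hc₁
        (cupDualH_bijective_ofGalois_mlf p₁ L₁ H₁ hH₁ res₁ res_smul₁ m₁))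
      ((ofGalois L₂ H₂ hH₂ res₂ res_smul₂).dualityIsoOfLocalDuality N eFN₂ hc₂
        (cupDualH_bijective_ofGalois_mlf p₂ L₂ H₂ hH₂ res₂ res_smul₂ m₂)) :=
  e.thm24i_of_cupProduct₂ N p₁ p₂ fs₁ fs₂
    (residueChar_eq_of_iso_ofGalois e galoisMLF_iso_residueChar_eq_holds) hfs eFN₁ eFN₂ hc₁ hc₂
    (cupDualH_bijective_ofGalois_mlf p₁ L₁ H₁ hH₁ res₁ res_smul₁ m₁)
    (cupDualH_bijective_ofGalois_mlf p₂ L₂ H₂ hH₂ res₂ res_smul₂ m₂)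

end Thm24iGalois

/-! ### Theorem 2.4 (i) at the zero-parameter arithmetic context `ofLocalField` -/

section Thm24iLocalField

variable {p₁ p₂ : ℕ} [Fact p₁.Prime] [Fact p₂.Prime]
  {K₁ : Type} [Field K₁] [Algebra ℚ_[p₁] K₁] [FiniteDimensional ℚ_[p₁] K₁]
  {K₂ : Type} [Field K₂] [Algebra ℚ_[p₂] K₂] [FiniteDimensional ℚ_[p₂] K₂]
  {L₁ : IntermediateField K₁ (AlgebraicClosure K₁)} [Normal K₁ L₁] [FiniteDimensional K₁ L₁]
  {H₁ : Subgroup (absoluteGaloisGroup K₁)} [H₁.Normal]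
  {hH₁ : IsOpen (H₁ : Set (absoluteGaloisGroup K₁))} {S₁ : StableSubmonoid L₁}
  {L₂ : IntermediateField K₂ (AlgebraicClosure K₂)} [Normal K₂ L₂] [FiniteDimensional K₂ L₂]
  {H₂ : Subgroup (absoluteGaloisGroup K₂)} [H₂.Normal]
  {hH₂ : IsOpen (H₂ : Set (absoluteGaloisGroup K₂))} {S₂ : StableSubmonoid L₂}
  (e : Iso (ofLocalField L₁ H₁ hH₁ S₁) (ofLocalField L₂ H₂ hH₂ S₂))
  (N : ℕ) [NeZero N]
  (hS₁ : ∀ x : L₁, x ^ N = 1 → x ∈ S₁.toSubmonoid)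
  (hμ₁ : ∀ ζ : rootsOfUnity N (AlgebraicClosure K₁),
    ((ζ : (AlgebraicClosure K₁)ˣ) : AlgebraicClosure K₁) ∈ L₁)
  (hS₂ : ∀ x : L₂, x ^ N = 1 → x ∈ S₂.toSubmonoid)
  (hμ₂ : ∀ ζ : rootsOfUnity N (AlgebraicClosure K₂),
    ((ζ : (AlgebraicClosure K₂)ˣ) : AlgebraicClosure K₂) ∈ L₂)
  [LocallyCompactSpace (ofLocalField L₁ H₁ hH₁ S₁).H]
  [LocallyCompactSpace (ofLocalField L₂ H₂ hH₂ S₂).H]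

/-- **Theorem 2.4 (i) at the arithmetic context `ofLocalField`** (FrdII pp. 19–20; `Kᵢ ⊇ ℚ_{pᵢ}`
finite, `A_{i,E} = Spec Lᵢ`, `O^□(Aᵢ) = O^□_{Lᵢ}` a `Gal(Lᵢ/Kᵢ)`-stable submonoid `Sᵢ` containing the
`N`-th roots of unity of `Lᵢ`, `μ_N(K̄ᵢ) ⊆ Lᵢ`): for a context isomorphism `e` "induced by `Ψ`",
`A₁` `(N, H₁)`-saturated and any normalisation `F_N(A₁) ≅ ℤ/Nℤ`, the typed `Thm24i` holds for the
cup-product duality isomorphisms — conditional on exactly `hfs` ("`Φ₁` fieldwise saturated iff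
`Φ₂`", [FrdI] Cor. 4.10/4.11); `p₁ = p₂`, the saturation transfer and the Kummer/reciprocity
compatibilities are proved, the local-duality inputs are `cupDualH_bijective_ofGalois_mlf` at
`muModelOfSubmonoid`. [cite: MochizukiFrdII2008, Thm 2.4 (i) p.19] -/
theorem thm24i_ofLocalField (fs₁ fs₂ : Prop) (hfs : fs₁ ↔ fs₂)
    (eFN₁ : FN (ofLocalField L₁ H₁ hH₁ S₁) N ≃+ ZMod N)
    (hc₁ : IsNHSaturated (ofLocalField L₁ H₁ hH₁ S₁) N) :
    Thm24i (ofLocalField L₁ H₁ hH₁ S₁) (ofLocalField L₂ H₂ hH₂ S₂) N p₁ p₂ fs₁ fs₂ (e.thm24Data N)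
      ((ofLocalField L₁ H₁ hH₁ S₁).dualityIsoOfLocalDuality N eFN₁ hc₁
        (cupDualH_bijective_ofGalois_mlf p₁ L₁ H₁ hH₁ (MonoidHom.id _) (fun _ _ => rfl)
          (muModelOfSubmonoid L₁ S₁ N hS₁ (NeZero.pos N) hμ₁)))
      ((ofLocalField L₂ H₂ hH₂ S₂).dualityIsoOfLocalDuality N ((e.isoFN N).symm.trans eFN₁)
        ((e.isNHSaturated_iff N).mp hc₁)
        (cupDualH_bijective_ofGalois_mlf p₂ L₂ H₂ hH₂ (MonoidHom.id _) (fun _ _ => rfl)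
          (muModelOfSubmonoid L₂ S₂ N hS₂ (NeZero.pos N) hμ₂))) :=
  thm24i_ofGalois e N (muModelOfSubmonoid L₁ S₁ N hS₁ (NeZero.pos N) hμ₁)
    (muModelOfSubmonoid L₂ S₂ N hS₂ (NeZero.pos N) hμ₂) fs₁ fs₂ hfs eFN₁ hc₁

end Thm24iLocalField

end Def22Context

end PadicKummer

end Literature.AlgebraicGeometry.Frobenioids

end
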